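import Mathlib
import HarnessLib
import Summits.NavierStokesRegularity.NavierStokesRegularity.Theorems.TypeILiouvilleLambTailSlaving

/-!
# TypeILiouvilleLambTailQuiescentIff — crux (L) stmt-NavierStokesRegularity-10661 `TypeIliouvilleL`:
# THE QUIESCENT RESIDUAL L_Q IS EXACTLY THE ASYMPTOTICALLY-BELTRAMI STRATUM (part 7 of `TypeILiouvilleLambTail`)

Helper for stmt-NavierStokesRegularity-10661 (`--supports`); theorems only, no definitions, no named-fact
hypotheses; closes no item; Navier–Stokes regularity is NOT proved here (leafhand seat of the EulerZoomLiouville route).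

Class P, `ω = curl v`, vortex commutator `f = Dv[ω] − Dω[v] = curl(v × ω)` as in parts 1–6.  Part 4 proved
`sup_x‖f(τ,·)‖ → 0 ⟹ quiescent`.  Here the converse:

* `fderiv_curl_fading_of_quiescent` — quiescent ⟹ `sup_x ‖∇ω(τ,x)‖ → 0` (Landau's inequality with an oscillation,
  `TypeILiouvilleQuiescentGradient.norm_fderiv_le_of_osc`, on the vorticity slices with their uniform `C²` bound).
* `commutator_fading_of_quiescent` — ★ quiescent ⟹ `sup_x ‖Dv[ω] − Dω[v]‖(τ,·) → 0`
  (`‖f‖ ≤ ‖∇v‖‖ω‖ + ‖∇ω‖ K`, each factor fading by the tree's dials).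
* `quiescent_iff_commutator_fading` — ★★ **for every member of print's class: QUIESCENT ⟺ ASYMPTOTICALLY
  (GENERALIZED) BELTRAMI** (`sup_x ‖curl(v × ω)(τ,x)‖ → 0` as `τ → −∞`).
* `quiescentLiouville_iff_asymptoticBeltramiLiouville` — ★★ **THE REGISTERED STUB L_Q (`stub_quiescentLiouville`,
  binders VERBATIM) IS EQUIVALENT TO THE ASYMPTOTICALLY-BELTRAMI LIOUVILLE STATEMENT** «every bounded ancient mild
  solution whose Lamb vector becomes curl-free in the far past, `sup_x‖curl(v × ω)(τ,·)‖ → 0`, is one constant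
  vector».  With `TypeILiouvilleGeneralizedBeltrami` (`curl(v × ω) ≡ 0` ⟹ constant, proved) and part 5
  (`‖curl(v × ω)‖ = O(e^{μτ})` ⟹ constant, proved) this places the open residual EXACTLY at sub-exponential decay
  of the Lamb curl.

HONEST LABEL: a reformulation and classical estimates; nothing here proves a registered stub, (L), or Navier–Stokes
regularity; rung 0.
[cite: KochNadirashviliSereginSverak2009, §4 (i), Lemma 6.1 (arXiv:0709.3599)] [cite: MajdaBertozziCUP2002, §2.3]
-/

noncomputable section
open MeasureTheory Filter Set Function Metric
open scoped Topology ENNReal RealInnerProductSpace Laplacian ContDiff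
open Literature.Analysis Literature.Analysis.FluidPDE Literature.Analysis.UnboundedOperators
set_option linter.dupNamespace false
namespace Summit.NavierStokesRegularity.NavierStokesRegularity.Theorems.TypeILiouvilleLambTail

/-- **Quiescent ⟹ the vorticity GRADIENT fades**: `sup_x ‖∇ω(τ,x)‖ → 0` as `τ → −∞` (Landau's inequality with the
oscillation `2 sup‖ω‖` of the fading vorticity and the uniform `C²` bound of the vorticity slices).
[cite: KochNadirashviliSereginSverak2009, §4 (arXiv:0709.3599)] -/
theorem fderiv_curl_fading_of_quiescent
    {v : ℝ → EuclideanSpace ℝ (Fin 3) → EuclideanSpace ℝ (Fin 3)}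
    (hc : ContinuousOn (uncurry v) (Iio 0 ×ˢ univ))
    (hK : ∃ K : ℝ, ∀ t < 0, ∀ x, ‖v t x‖ ≤ K)
    (hd : ∀ t < 0, IsWeaklyDivFree (v t))
    (hm : ∀ s t : ℝ, s < t → t < 0 → ∀ x,
      v t x = heatExtension (v s) (t - s) x - oseenDuhamel 1 s v v t x)
    (hq : ∀ ε : ℝ, 0 < ε → ∃ T : ℝ, T < 0 ∧ ∀ t < T, ∀ x y : EuclideanSpace ℝ (Fin 3),
      dist x y ≤ 1 → ‖v t x - v t y‖ ≤ ε) :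
    ∀ δ : ℝ, 0 < δ → ∃ T : ℝ, T < 0 ∧ ∀ τ < T, ∀ x, ‖fderiv ℝ (curl (v τ)) x‖ ≤ δ := by
  intro δ hδ
  obtain ⟨K, hKb⟩ := hK
  obtain ⟨hsm', -⟩ := smooth_and_bounds_of_bounded_ancient_oseenMild hc hd hm hKb
  have hsm : IsSmoothSpaceTimeOn (Iio 0) v := hsm'
  have hvort : IsSmoothSpaceTimeOn (Iio 0) (vorticity v) := isSmoothSpaceTimeOn_vorticity_Iio hsm
  obtain ⟨D₂, hD₂⟩ := classP_norm_iteratedFDeriv_curl_le hc ⟨K, hKb⟩ hd hm 2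
  have hD₂0 : 0 ≤ D₂ := (norm_nonneg _).trans (hD₂ (-1) (by norm_num) 0)
  -- Landau scale `s` with `s D₂ ≤ δ/2`, oscillation tolerance `ε = s δ / 4`
  set s : ℝ := min (1 / 2) (δ / (2 * (D₂ + 1))) with hs_def
  have hs : 0 < s := lt_min (by norm_num) (by positivity)
  have hs1 : s < 1 := (min_le_left _ _).trans_lt (by norm_num)
  have hsD : s * D₂ ≤ δ / 2 := by
    have h1 : s ≤ δ / (2 * (D₂ + 1)) := min_le_right _ _
    calc s * D₂ ≤ δ / (2 * (D₂ + 1)) * D₂ := mul_le_mul_of_nonneg_right h1 hD₂0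
      _ ≤ δ / (2 * (D₂ + 1)) * (D₂ + 1) := mul_le_mul_of_nonneg_left (by linarith) (by positivity)
      _ = δ / 2 := by field_simp
  obtain ⟨T, hT0, hT⟩ := TypeILiouvilleStrainLedger.curl_fading_of_quiescent hc ⟨K, hKb⟩ hd hm hq
    (s * δ / 8) (by positivity)
  refine ⟨T, hT0, fun τ hτ x => ?_⟩
  have hτ0 : τ < 0 := hτ.trans hT0
  have hf : ContDiff ℝ ∞ (curl (v τ)) := hvort.contDiff_slice (mem_Iio.2 hτ0)
  have hosc : ∀ y ∈ ball x (1 : ℝ), ‖curl (v τ) y - curl (v τ) x‖ ≤ s * δ / 4 := fun y _ =>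
    (norm_sub_le _ _).trans (by linarith [hT τ hτ y, hT τ hτ x])
  have h := TypeILiouvilleQuiescentGradient.norm_fderiv_le_of_osc hf hD₂0 (hD₂ τ hτ0) hosc hs hs1
  calc ‖fderiv ℝ (curl (v τ)) x‖ ≤ 2 * (s * δ / 4) / s + s * D₂ := h
    _ = δ / 2 + s * D₂ := by field_simp; ring
    _ ≤ δ := by linarith

/-- ★ **QUIESCENT ⟹ ASYMPTOTICALLY BELTRAMI**: for a quiescent member of print's class the vortex commutator fades,
`sup_x ‖Dv[ω] − Dω[v]‖(τ,·) → 0` as `τ → −∞` (`‖f‖ ≤ ‖∇v‖‖ω‖ + ‖∇ω‖ K`; gradient dial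
`TypeILiouvilleQuiescentGradient.fderiv_small_of_quiescent`, vorticity dial `curl_fading_of_quiescent`, and the vorticity
gradient dial above). [cite: KochNadirashviliSereginSverak2009, §4, Lemma 6.1 (arXiv:0709.3599)] -/
theorem commutator_fading_of_quiescent
    {v : ℝ → EuclideanSpace ℝ (Fin 3) → EuclideanSpace ℝ (Fin 3)}
    (hc : ContinuousOn (uncurry v) (Iio 0 ×ˢ univ))
    (hK : ∃ K : ℝ, ∀ t < 0, ∀ x, ‖v t x‖ ≤ K)
    (hd : ∀ t < 0, IsWeaklyDivFree (v t))
    (hm : ∀ s t : ℝ, s < t → t < 0 → ∀ x,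
      v t x = heatExtension (v s) (t - s) x - oseenDuhamel 1 s v v t x)
    (hq : ∀ ε : ℝ, 0 < ε → ∃ T : ℝ, T < 0 ∧ ∀ t < T, ∀ x y : EuclideanSpace ℝ (Fin 3),
      dist x y ≤ 1 → ‖v t x - v t y‖ ≤ ε) :
    ∀ η : ℝ, 0 < η → ∃ T : ℝ, T < 0 ∧ ∀ τ < T, ∀ x : EuclideanSpace ℝ (Fin 3),
      ‖fderiv ℝ (v τ) x (curl (v τ) x) - fderiv ℝ (curl (v τ)) x (v τ x)‖ ≤ η := by
  intro η hη
  obtain ⟨K, hKb⟩ := hK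
  have hK0 : 0 ≤ K := (norm_nonneg _).trans (hKb (-1) (by norm_num) 0)
  obtain ⟨T₁, hT₁0, hT₁⟩ := TypeILiouvilleQuiescentGradient.fderiv_small_of_quiescent hc ⟨K, hKb⟩ hd hm hq 1 one_pos
  obtain ⟨T₂, hT₂0, hT₂⟩ := TypeILiouvilleStrainLedger.curl_fading_of_quiescent hc ⟨K, hKb⟩ hd hm hq
    (η / 2) (half_pos hη)
  obtain ⟨T₃, -, hT₃⟩ := fderiv_curl_fading_of_quiescent hc ⟨K, hKb⟩ hd hm hq
    (η / (2 * (K + 1))) (by positivity)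
  refine ⟨min T₁ (min T₂ T₃), by
    have := min_le_left T₁ (min T₂ T₃); linarith, fun τ hτ x => ?_⟩
  have hτ1 : τ < T₁ := lt_of_lt_of_le hτ (min_le_left _ _)
  have hτ2 : τ < T₂ := lt_of_lt_of_le hτ ((min_le_right _ _).trans (min_le_left _ _))
  have hτ3 : τ < T₃ := lt_of_lt_of_le hτ ((min_le_right _ _).trans (min_le_right _ _))
  have hτ0 : τ < 0 := hτ1.trans hT₁0
  have h1 : ‖fderiv ℝ (v τ) x (curl (v τ) x)‖ ≤ 1 * (η / 2) :=
    (ContinuousLinearMap.le_opNorm _ _).trans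
      (mul_le_mul (hT₁ τ hτ1 x) (hT₂ τ hτ2 x) (norm_nonneg _) zero_le_one)
  have h2 : ‖fderiv ℝ (curl (v τ)) x (v τ x)‖ ≤ η / (2 * (K + 1)) * K :=
    (ContinuousLinearMap.le_opNorm _ _).trans
      (mul_le_mul (hT₃ τ hτ3 x) (hKb τ hτ0 x) (norm_nonneg _) (by positivity))
  have h3 : η / (2 * (K + 1)) * K ≤ η / 2 := by
    rw [div_mul_eq_mul_div, div_le_div_iff₀ (by positivity) (by norm_num)]
    nlinarith
  calc ‖fderiv ℝ (v τ) x (curl (v τ) x) - fderiv ℝ (curl (v τ)) x (v τ x)‖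
      ≤ ‖fderiv ℝ (v τ) x (curl (v τ) x)‖ + ‖fderiv ℝ (curl (v τ)) x (v τ x)‖ := norm_sub_le _ _
    _ ≤ 1 * (η / 2) + η / 2 := add_le_add h1 (h2.trans h3)
    _ = η := by ring

/-- ★★ **QUIESCENT ⟺ ASYMPTOTICALLY BELTRAMI, for every member of print's class P**: the unit oscillation of the slices
tends to zero as `t → −∞` iff the vortex commutator `Dv[ω] − Dω[v] = curl(v × ω)` tends to zero uniformly.
[cite: KochNadirashviliSereginSverak2009, §4, Lemma 6.1 (arXiv:0709.3599)] [cite: MajdaBertozziCUP2002, §2.3] -/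
theorem quiescent_iff_commutator_fading
    {v : ℝ → EuclideanSpace ℝ (Fin 3) → EuclideanSpace ℝ (Fin 3)}
    (hc : ContinuousOn (uncurry v) (Iio 0 ×ˢ univ))
    (hK : ∃ K : ℝ, ∀ t < 0, ∀ x, ‖v t x‖ ≤ K)
    (hd : ∀ t < 0, IsWeaklyDivFree (v t))
    (hm : ∀ s t : ℝ, s < t → t < 0 → ∀ x,
      v t x = heatExtension (v s) (t - s) x - oseenDuhamel 1 s v v t x) :
    (∀ ε : ℝ, 0 < ε → ∃ T : ℝ, T < 0 ∧ ∀ t < T, ∀ x y : EuclideanSpace ℝ (Fin 3),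
      dist x y ≤ 1 → ‖v t x - v t y‖ ≤ ε) ↔
    (∀ η : ℝ, 0 < η → ∃ T : ℝ, T < 0 ∧ ∀ τ < T, ∀ x : EuclideanSpace ℝ (Fin 3),
      ‖fderiv ℝ (v τ) x (curl (v τ) x) - fderiv ℝ (curl (v τ)) x (v τ x)‖ ≤ η) :=
  ⟨commutator_fading_of_quiescent hc hK hd hm, quiescent_of_commutator_fading hc hK hd hm⟩

/-- ★★ **L_Q ⟺ ASYMPTOTICALLY-BELTRAMI LIOUVILLE** (exact, unconditional).  Left: the registered stub
`stub_quiescentLiouville` of the (L) crux, binders verbatim.  Right: «every member of print's class whose vortex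
commutator `Dv[ω] − Dω[v] = curl(v × ω)` tends to zero uniformly as `τ → −∞` is one constant vector».  The open
residual of (L) on this axis is therefore EXACTLY the sub-exponentially decaying Lamb curls (exponential decay ⟹
constant, part 5; identically zero ⟹ constant, `TypeILiouvilleGeneralizedBeltrami`).
[cite: KochNadirashviliSereginSverak2009, §4 (i), Lemma 6.1 (arXiv:0709.3599)] -/
theorem quiescentLiouville_iff_asymptoticBeltramiLiouville :
    (∀ v : ℝ → EuclideanSpace ℝ (Fin 3) → EuclideanSpace ℝ (Fin 3),
      ContinuousOn (Function.uncurry v) (Set.Iio 0 ×ˢ Set.univ) →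
      (∃ K : ℝ, ∀ t < 0, ∀ x, ‖v t x‖ ≤ K) →
      (∀ t < 0, Literature.Analysis.FluidPDE.IsWeaklyDivFree (v t)) →
      (∀ s t : ℝ, s < t → t < 0 → ∀ x,
        v t x = Literature.Analysis.UnboundedOperators.heatExtension (v s) (t - s) x -
          Literature.Analysis.FluidPDE.oseenDuhamel 1 s v v t x) →
      (∀ ε : ℝ, 0 < ε → ∃ T : ℝ, T < 0 ∧ ∀ t < T, ∀ x y : EuclideanSpace ℝ (Fin 3),
        dist x y ≤ 1 → ‖v t x - v t y‖ ≤ ε) →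
      ∃ b : EuclideanSpace ℝ (Fin 3), ∀ t < 0, ∀ x, v t x = b) ↔
    (∀ v : ℝ → EuclideanSpace ℝ (Fin 3) → EuclideanSpace ℝ (Fin 3),
      ContinuousOn (Function.uncurry v) (Set.Iio 0 ×ˢ Set.univ) →
      (∃ K : ℝ, ∀ t < 0, ∀ x, ‖v t x‖ ≤ K) →
      (∀ t < 0, Literature.Analysis.FluidPDE.IsWeaklyDivFree (v t)) →
      (∀ s t : ℝ, s < t → t < 0 → ∀ x,
        v t x = Literature.Analysis.UnboundedOperators.heatExtension (v s) (t - s) x -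
          Literature.Analysis.FluidPDE.oseenDuhamel 1 s v v t x) →
      (∀ η : ℝ, 0 < η → ∃ T : ℝ, T < 0 ∧ ∀ τ < T, ∀ x : EuclideanSpace ℝ (Fin 3),
        ‖fderiv ℝ (v τ) x (curl (v τ) x) - fderiv ℝ (curl (v τ)) x (v τ x)‖ ≤ η) →
      ∃ b : EuclideanSpace ℝ (Fin 3), ∀ t < 0, ∀ x, v t x = b) := by
  constructor
  · intro hQ v hc hK hd hm hf
    exact hQ v hc hK hd hm (quiescent_of_commutator_fading hc hK hd hm hf)
  · intro hB v hc hK hd hm hq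
    exact hB v hc hK hd hm (commutator_fading_of_quiescent hc hK hd hm hq)

end Summit.NavierStokesRegularity.NavierStokesRegularity.Theorems.TypeILiouvilleLambTail

end
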